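import Literature.NumberTheory.LFunctions.Zhang2022.RepairLengthKnifeEdge
import Literature.NumberTheory.LFunctions.Zhang2022.KnifeEdgeLenZDegreeShort
import Summits.Parity.GeneralizedHardyLittlewood.Theorems.PsiGradedTablesClosePoly.Negative.DarkCellsNoClosing
import HarnessLib

/-!
# Negative lane of `PsiGradedTablesClosePoly` (h2′) / `LongPairsGradedTables` (𝒳₂): a KERNEL threshold number at the best
# twisted sub-unit design — `0.3385 < 𝔅(ϰ_{9/10, 17/10}) < 0.3388`

Y. Zhang, *Discrete mean estimates and the Landau–Siegel zero*, arXiv:2211.02515v1 [Zhang2022LandauSiegel] — an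
unrefereed manuscript under adjudication; nothing here asserts any of its claims and nothing here is a statement about
Landau–Siegel zeros. Desk lemma of the §G referee (ls-ref-1; F1-THRESHOLD v1.1 e4a00af126921454), (A)-free:

* `subunit_sound` / `subunitCert_nine_tenths` / `subunitCert_three_fifths` — the certificate machinery of `RepairLengthKnifeEdge` (boxes
  `cDiagBL` of `RepairSection9Boxes`, valid at every real length) with the twist `k` as a parameter, run at the two
  sub-unit twisted pieces `ϰ_{9/10,17/10}` and `ϰ_{3/5,21/10}` (`decide +kernel`; the check is written inline, no new definition);
* `mainTermForm_kappaP_nine_tenths` — **`0.3385 < 𝔅(ϰ_{9/10,17/10}) < 0.3388`**; `mainTermForm_kappaP_three_fifths` —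
  **`0.5194 < 𝔅(ϰ_{3/5,21/10}) < 0.5197`** (desk numerics: `0.338638`, `0.519514`; the untwisted linear piece of length
  `9/10` has `𝔅 ≈ 41.99`);
* `inClassPiece_kappaP`, `shortPiece_kappaP` — `ϰ_{ν,k}` (`0 < ν ≤ 1`) is an in-class piece, short of length `ν`; so the
  design `(ϰ_{9/10,17/10})³` has all three pairs LONG (`9/10 + 9/10 ≥ 1`, `not_shortPairs_kappaP_nine_tenths`);
* `row_threshold_kappaP_nine_tenths` — with `DarkCellsNoClosing.exists_row_excess_of_gradedClosesOn`: a closing witness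
  at this design needs a row mass `> 0.3385`, i.e. some long cell of modulus `> 0.169`; and by
  `gradedClosesOn_of_minor02` one cell of modulus `≥ 0.5821` (`0.5821² > 0.3388²`... stated as `𝔅·𝔅 < ‖X₂‖²`) suffices.

The pieces `ϰ_{ν,k}` are kinked H¹ pieces, NOT polynomial: they lie in the long class of 𝒳₂ (`¬ShortPairs`), and are
`𝔅`-limits of polynomial short pieces of the same length (`ShortPiece.exists_polyShortPiece_approx`), so the numbers are
the threshold SCALE for h2′'s sub-unit poly class as well (desk reading; no density statement is proved here).
No Theses statement asserted; no new `Prop`; axioms standard (`decide +kernel`, no `native_decide`).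
-/

noncomputable section

open Complex Real ComplexConjugate Set MeasureTheory intervalIntegral
open Literature.Analysis.ValidatedNumerics.Numerics

namespace Summit.Parity.GeneralizedHardyLittlewood.Theorems.PsiGradedTablesClosePoly.Negative

open Literature.NumberTheory.LFunctions.Zhang2022 Literature.NumberTheory.LFunctions.Zhang2022.KnifeEdge
open Literature.NumberTheory.LFunctions.Zhang2022.Repair

/-! ### Part 1 — the twisted sub-unit pieces are in-class, short of their length, and pairwise long -/

/-- `ϰ_{ν,k}` with `0 < ν ≤ 1` is an in-class piece (kinked H¹ on `[0,1]`, zero from `ν ≤ 1` on).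
[cite: Zhang2022LandauSiegel, (2.23)–(2.25) p.9; §7 (7.2) p.44] -/
theorem inClassPiece_kappaP {ν : ℝ} (hν : 0 < ν) (hν1 : ν ≤ 1) (k : ℝ) : InClassPiece (kappaP ν k) (kappaP' ν k) where
  kinked := kinkedProfile_kappaP hν hν1
  vanish := fun _ hy => kappaP_of_ge hν.ne' (hν1.trans hy)
  vanish' := fun _ hy => kappaP'_of_ge (hν1.trans hy)

/-- `ϰ_{ν,k}` is a short piece of length `ν`. [cite: Zhang2022LandauSiegel, (2.23)–(2.25) p.9; §7 (7.2) p.13] -/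
theorem shortPiece_kappaP {ν : ℝ} (hν : 0 < ν) (hν1 : ν ≤ 1) (k : ℝ) : ShortPiece ν (kappaP ν k) (kappaP' ν k) where
  inClass := inClassPiece_kappaP hν hν1 k
  vanish := fun _ hy => kappaP_of_ge hν.ne' hy
  vanish' := fun _ hy => kappaP'_of_ge hy

/-- `ϰ_{ν,k}` is short of length `θ` only if `ν ≤ θ` (it does not vanish just below `ν`). [cite: Zhang2022LandauSiegel, (2.23)–(2.25) p.9] -/
theorem le_of_shortPiece_kappaP {ν θ k : ℝ} (hν : 0 < ν) (h : ShortPiece θ (kappaP ν k) (kappaP' ν k)) : ν ≤ θ := by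
  by_contra hlt
  push Not at hlt
  -- at y = max θ (ν/2) < ν the piece is (1 − y/ν)e^{…} ≠ 0, but `h.vanish` says it is 0
  set y := max θ (ν / 2) with hy
  have hyν : y < ν := max_lt hlt (by linarith)
  have hθy : θ ≤ y := le_max_left _ _
  have hzero := h.vanish y hθy
  have hne : kappaP ν k y ≠ 0 := by
    unfold kappaP
    rw [if_pos hyν.le]
    refine mul_ne_zero ?_ (Complex.exp_ne_zero _)
    have : (0 : ℝ) < 1 - y / ν := by
      rw [sub_pos, div_lt_one hν]; exact hyν
    exact_mod_cast this.ne'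
  exact hne hzero

/-- The design `(ϰ_{9/10,k}, ϰ_{9/10,k'})` is a LONG pair: no representation `θ_f + θ_g < 1`.
[cite: Zhang2022LandauSiegel, §7 (7.2) p.13] -/
theorem not_shortPairs_kappaP_nine_tenths (k k' : ℝ) :
    ¬ ShortPairs (kappaP (9/10) k) (kappaP' (9/10) k) (kappaP (9/10) k') (kappaP' (9/10) k') := by
  rintro ⟨θf, θg, hsum, hf, hg⟩
  have h1 := le_of_shortPiece_kappaP (by norm_num) hf
  have h2 := le_of_shortPiece_kappaP (by norm_num) hg
  linarith

/-! ### Part 2 — the certificate (boxes of `RepairSection9Boxes`, twist as a parameter) -/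

/- Keep the interval primitives opaque to the elaborator's unifier (as in `RepairLengthKnifeEdge`). -/
attribute [local irreducible] CB.add CB.sub CB.mul CB.neg CB.conj CB.mulFI CB.mulI CB.mulInt
  CB.ofFI CB.ofInt CB.normSqFI CB.expI FI.add FI.sub FI.mul FI.neg FI.mulInt FI.divNat FI.divPos
  FI.ofRat FI.ofInt FI.pi qCB piMul expIpi overPiFI piISq mulPiFI scaleRatFI recipFI
  recipMulPiFI expIpiFI

/-- soundness of the leaf check at twist `k` over `ν ∈ [a, b]` (the check of `RepairLengthKnifeEdge.knifeOK` with the twist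
as a parameter, written inline — flag `bDiagOK` and a rational bracket of `Re c(k, ν)`; no new definition). [cite: Moore1966, Theorem 3.1] -/
theorem subunit_sound {k a b lo hi : ℚ} (hk : k ≠ 0)
    (h : (bDiagOK k (FI.ofRatRat a b)
      && decide (lo * (SC : ℚ) < ((cDiagBL k (FI.ofRatRat a b)).re.lo : ℚ))
      && decide (((cDiagBL k (FI.ofRatRat a b)).re.hi : ℚ) < hi * (SC : ℚ))) = true)
    {ν : ℝ} (ha : (a : ℝ) ≤ ν) (hb : ν ≤ (b : ℝ)) : (lo : ℝ) < (cDiag k ν).re ∧ (cDiag k ν).re < (hi : ℝ) := by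
  simp only [Bool.and_eq_true, decide_eq_true_eq] at h
  obtain ⟨⟨hok, hlo⟩, hhi⟩ := h
  have hm := mem_cDiagBL hk (FI.mem_ofRatRat ha hb) hok
  exact ⟨lo_bound hm.1 hlo, hi_bound hm.1 hhi⟩

/-- The certificate at `(k, ν) = (17/10, 9/10)` (`decide +kernel`): `Re c(17/10, 9/10) ∈ (0.3385, 0.3388)`. [cite: Moore1966, Theorem 3.1] -/
theorem subunitCert_nine_tenths :
    (bDiagOK (17/10) (FI.ofRatRat (9/10) (9/10))
      && decide (((3385/10000 : ℚ)) * (SC : ℚ) < ((cDiagBL (17/10) (FI.ofRatRat (9/10) (9/10))).re.lo : ℚ))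
      && decide (((cDiagBL (17/10) (FI.ofRatRat (9/10) (9/10))).re.hi : ℚ) < ((3388/10000 : ℚ)) * (SC : ℚ))) = true := by
  decide +kernel

/-- The certificate at `(k, ν) = (21/10, 3/5)` (`decide +kernel`): `Re c(21/10, 3/5) ∈ (0.5194, 0.5197)`. [cite: Moore1966, Theorem 3.1] -/
theorem subunitCert_three_fifths :
    (bDiagOK (21/10) (FI.ofRatRat (3/5) (3/5))
      && decide (((5194/10000 : ℚ)) * (SC : ℚ) < ((cDiagBL (21/10) (FI.ofRatRat (3/5) (3/5))).re.lo : ℚ))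
      && decide (((cDiagBL (21/10) (FI.ofRatRat (3/5) (3/5))).re.hi : ℚ) < ((5197/10000 : ℚ)) * (SC : ℚ))) = true := by
  decide +kernel

/-- From the boxed functional to `𝔅` on a sub-unit piece at rational twist. [cite: Zhang2022LandauSiegel, (8.19)–(8.20), (9.3)–(9.4)] -/
theorem mainTermForm_kappaP_eq_cDiag_re (k : ℚ) {ν : ℝ} (hν : 0 < ν) (hν1 : ν ≤ 1) (hk : k ≠ 0) :
    mainTermForm (kappaP ν k) (kappaP' ν k) = (cDiag k ν).re := by
  have hk' : ((k : ℚ) : ℝ) ≠ 0 := by exact_mod_cast hk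
  rw [← kappaDiagTop_ratCast k hν hk, kappaDiagTop_eq_mainTermForm hν hν1 hk', Complex.ofReal_re]

/-- **`0.3385 < 𝔅(ϰ_{9/10,17/10}) < 0.3388`** — the diagonal main-term form of the best twisted piece of length `9/10`
(desk scan over `k`; untwisted `𝔅(9/10 − x) ≈ 41.99`). [cite: Zhang2022LandauSiegel, (2.23)–(2.25) p.9, Prop 7.1 p.44] -/
theorem mainTermForm_kappaP_nine_tenths :
    (0.3385 : ℝ) < mainTermForm (kappaP (9/10) (17/10)) (kappaP' (9/10) (17/10))
      ∧ mainTermForm (kappaP (9/10) (17/10)) (kappaP' (9/10) (17/10)) < 0.3388 := by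
  have e : ((17/10 : ℚ) : ℝ) = (17/10 : ℝ) := by norm_num
  have h := subunit_sound (by norm_num) subunitCert_nine_tenths (ν := 9/10) (by norm_num) (by norm_num)
  rw [← e, mainTermForm_kappaP_eq_cDiag_re (17/10) (by norm_num) (by norm_num) (by norm_num)]
  push_cast at h
  exact ⟨by linarith [h.1], by linarith [h.2]⟩

/-- **`0.5194 < 𝔅(ϰ_{3/5,21/10}) < 0.5197`.** [cite: Zhang2022LandauSiegel, (2.23)–(2.25) p.9, Prop 7.1 p.44] -/
theorem mainTermForm_kappaP_three_fifths :
    (0.5194 : ℝ) < mainTermForm (kappaP (3/5) (21/10)) (kappaP' (3/5) (21/10))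
      ∧ mainTermForm (kappaP (3/5) (21/10)) (kappaP' (3/5) (21/10)) < 0.5197 := by
  have e : ((21/10 : ℚ) : ℝ) = (21/10 : ℝ) := by norm_num
  have h := subunit_sound (by norm_num) subunitCert_three_fifths (ν := 3/5) (by norm_num) (by norm_num)
  rw [← e, mainTermForm_kappaP_eq_cDiag_re (21/10) (by norm_num) (by norm_num) (by norm_num)]
  push_cast at h
  exact ⟨by linarith [h.1], by linarith [h.2]⟩

/-! ### Part 3 — the threshold at the twisted design, by name -/

/-- **Row threshold at the design `(ϰ_{9/10,17/10})³` (proved):** if the graded form closes at amplitudes `s` on this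
design, some row's off-diagonal mass exceeds `0.3385` — so some long cell has modulus `> 0.169`.
[cite: Zhang2022LandauSiegel, §2 (2.16)–(2.17), §7 Prop 7.1 (7.2)] -/
theorem row_threshold_kappaP_nine_tenths {X₁ Y₁ X₂ : PairFunctional} {s : Fin 3 → ℂ}
    (h : gradedQuadForm (gradedMainMatrix X₁ Y₁ X₂ (kappaP (9/10) (17/10)) (kappaP' (9/10) (17/10))
      (kappaP (9/10) (17/10)) (kappaP' (9/10) (17/10)) (kappaP (9/10) (17/10)) (kappaP' (9/10) (17/10))) s < 0) :
    let κ := kappaP (9/10) (17/10); let κ' := kappaP' (9/10) (17/10)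
    (0.3385 : ℝ) < ‖X₁ κ κ' κ κ'‖ + ‖X₂ κ κ' κ κ'‖ ∨ (0.3385 : ℝ) < ‖X₁ κ κ' κ κ'‖ + ‖Y₁ κ κ' κ κ'‖
      ∨ (0.3385 : ℝ) < ‖X₂ κ κ' κ κ'‖ + ‖Y₁ κ κ' κ κ'‖ := by
  intro κ κ'
  have hB := mainTermForm_kappaP_nine_tenths.1
  have hG := gradedQuadForm_ge_rows X₁ Y₁ X₂ κ κ' κ κ' κ κ' s
  by_contra hcon
  push Not at hcon
  obtain ⟨h0, h1, h2⟩ := hcon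
  nlinarith [mul_nonneg (by linarith : (0:ℝ) ≤ mainTermForm κ κ' - (‖X₁ κ κ' κ κ'‖ + ‖X₂ κ κ' κ κ'‖)) (sq_nonneg ‖s 0‖),
    mul_nonneg (by linarith : (0:ℝ) ≤ mainTermForm κ κ' - (‖X₁ κ κ' κ κ'‖ + ‖Y₁ κ κ' κ κ'‖)) (sq_nonneg ‖s 1‖),
    mul_nonneg (by linarith : (0:ℝ) ≤ mainTermForm κ κ' - (‖X₂ κ κ' κ κ'‖ + ‖Y₁ κ κ' κ κ'‖)) (sq_nonneg ‖s 2‖)]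

/-- **One-cell certificate at the twisted design (proved):** if the class `𝒞` contains the pair `(ϰ_{9/10,17/10}, ϰ_{9/10,17/10})`
and the NEW table there has `‖X₂‖² > 0.3388²`-worth of mass in the exact form `𝔅·𝔅 < ‖X₂‖²` — guaranteed by
`0.1148 ≤ ‖X₂‖²` — then `GradedClosesOn 𝒞 X₁ Y₁ X₂`. [cite: Zhang2022LandauSiegel, §2 (2.16), §7 Prop 7.1 (7.2)] -/
theorem gradedClosesOn_kappaP_nine_tenths_of_cell {𝒞 : PairClass} {X₁ Y₁ X₂ : PairFunctional}
    (h𝒞 : 𝒞 (kappaP (9/10) (17/10)) (kappaP' (9/10) (17/10)) (kappaP (9/10) (17/10)) (kappaP' (9/10) (17/10)))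
    (hX : (0.1148 : ℝ) ≤ ‖X₂ (kappaP (9/10) (17/10)) (kappaP' (9/10) (17/10)) (kappaP (9/10) (17/10)) (kappaP' (9/10) (17/10))‖ ^ 2) :
    GradedClosesOn 𝒞 X₁ Y₁ X₂ := by
  have hκ := inClassPiece_kappaP (ν := 9/10) (by norm_num) (by norm_num) (17/10)
  have hB := mainTermForm_kappaP_nine_tenths
  refine gradedClosesOn_of_minor02 hκ hκ hκ h𝒞 h𝒞 h𝒞 ?_
  have hBnn : (0:ℝ) ≤ mainTermForm (kappaP (9/10) (17/10)) (kappaP' (9/10) (17/10)) := by linarith [hB.1]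
  nlinarith [hB.1, hB.2, mul_le_mul hB.2.le hB.2.le hBnn (by norm_num)]

end Summit.Parity.GeneralizedHardyLittlewood.Theorems.PsiGradedTablesClosePoly.Negative

end
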